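import Literature.MathematicalPhysics.StatisticalMechanics.ComplexSpinChiralLROHighDimension
import Literature.Probability.LatticeModels.LatticeGreenDimensionMonotone
import HarnessLib

/-!
# Chiral long-range order in all dimensions above a threshold: the monotone bound of Prop. 4.2 (2)
# (Salmhofer–Seiler, CMP 139 (1991), Prop. 4.2 (2) with Prop. A.6; (A.60)–(A.61); Cor. 4.9)

Thirteenth file of the Salmhofer–Seiler series; theorems only (no definition, no named fact).
`ComplexSpinFluctuationBound` proves `S(ν) ≤ νR(ν) - 3/4` (Prop. 4.2 (2), first inequality) and
Thm. 4.8 / Cor. 4.9 in the form "`2S(ν)K(N)/N < 1` ⇒ chiral LRO at `m = 0`, uniformly in the even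
volume"; `ComplexSpinChiralLROHighDimension` adds `R(ν) ≤ 1/(ν - 2)` and the numerics-free thresholds
`ν ≥ 11, 11, 13, 20`; `LatticeGreenDimensionMonotone` proves Proposition A.6, `ν R(ν)` non-increasing.
Here the three are combined into the clause of Prop. 4.2 (2) that was still missing and its uses:

* `fluctSBound_le_of_le`, `dimBound_le_of_le` — **Prop. 4.2 (2) (4.4): "both upper bounds
  [`νR(ν) - 3/4` and `ν/(ν-2) - 3/4`] are decreasing functions of `ν`"**;
* `fluctS_le_of_le` — hence `S(ν) ≤ ν₀R(ν₀) - 3/4` for all `ν ≥ ν₀ ≥ 3` ((A.61): "the upper bound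
  `S(ν) ≤ νR(ν) - 3/4` is decreasing");
* `chiralLRO_of_latticeGreen_lt`, `uN_chiralLRO_of_latticeGreen_lt` — Thm. 4.8 / Cor. 4.9 for ALL
  `ν ≥ ν₀` from ONE inequality `2(ν₀R(ν₀) - 3/4)K(N)/N < 1` at the base dimension `ν₀`;
* `u1_chiralLRO_of_latticeGreen_four_lt`, `u2_chiralLRO_of_latticeGreen_four_lt` — the printed
  remark (A.60), p. 430: "`S(4) ≤ 4R(4) - 3/4 < 1/2`, so that already this bound suffices to prove
  symmetry breaking for QED […] and the `U(2)`-model for `ν = 4` (and also all `ν ≥ 4` …)", with its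
  one computer-assisted input `R(4) < 5/16` (printed: `R(4) ≤ 0.3100`, p. 430) kept as an explicit
  HYPOTHESIS; likewise `u3_chiralLRO_of_latticeGreen_five_lt` (`R(5) < 6/25`; printed `R(5) ≤ 0.2313`)
  for `U(3)`, `ν ≥ 5`, and `u4_chiralLRO_of_latticeGreen_seven_lt` (`R(7) < 369/2324 ≈ 0.1588`;
  printed `R(7) ≤ 0.1564`) for `U(4)`, `ν ≥ 7`.

What is NOT formalised: the numerical values of `R(ν)` themselves (Prop. 4.2 (4) and p. 430 are
computer-assisted in print: "majorize [the convex decreasing integrand of (A.7)] by a piecewise linear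
map … and thus get arbitrarily accurate upper bounds for `R(ν)`"), and `S(4) < 0.35` (needed for
`U(3)`, `U(4)` AT `ν = 4, 5, 6`).  The unconditional, numerics-free thresholds remain those of
`ComplexSpinChiralLROHighDimension` (`ν ≥ 11, 11, 13, 20, 94`).  Honest framing: `β = 0` complex spin
systems (Salmhofer–Seiler's bosonised `U(N)` one-link integral) on even tori; nothing about `β > 0`,
the continuum, `SU(N)` or the summit's `QCD` conjunct.

## References

* M. Salmhofer, E. Seiler, Commun. Math. Phys. 139 (1991) 395–432: Prop. 4.2 (2) (4.4) (p. 418),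
  Thm. 4.8, Cor. 4.9, Remark A.5 (A.28), Proposition A.6 (p. 427), (A.60)–(A.61) and the table of
  `R(ν)` (pp. 430–431). [SalmhoferSeiler1991]
-/

noncomputable section

open MeasureTheory Set Filter Finset
open Literature.Probability.LatticeModels

namespace Literature.MathematicalPhysics.StatisticalMechanics

namespace ComplexSpin

variable {ν ν₀ : ℕ}

/-! ### Prop. 4.2 (2): both upper bounds are decreasing in `ν` -/

/-- **Prop. 4.2 (2), monotonicity of the first bound**: `νR(ν) - 3/4 ≤ ν₀R(ν₀) - 3/4` for
`3 ≤ ν₀ ≤ ν` (Proposition A.6, `dim_mul_latticeGreen_zero_le_of_le`).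
[cite: SalmhoferSeiler1991, Prop. 4.2 (2) with Proposition A.6] -/
theorem fluctSBound_le_of_le (hν₀ : 3 ≤ ν₀) (hle : ν₀ ≤ ν) :
    (ν : ℝ) * latticeGreen (0 : Site ν) - 3 / 4 ≤ (ν₀ : ℝ) * latticeGreen (0 : Site ν₀) - 3 / 4 := by
  have h := dim_mul_latticeGreen_zero_le_of_le hν₀ hle
  linarith

/-- **Prop. 4.2 (2), monotonicity of the second bound**: `ν/(ν-2) - 3/4 ≤ ν₀/(ν₀-2) - 3/4` for
`3 ≤ ν₀ ≤ ν` (elementary: `ν/(ν-2) = 1 + 2/(ν-2)`). [cite: SalmhoferSeiler1991, Prop. 4.2 (2)] -/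
theorem dimBound_le_of_le (hν₀ : 3 ≤ ν₀) (hle : ν₀ ≤ ν) :
    (ν : ℝ) / ((ν : ℝ) - 2) - 3 / 4 ≤ (ν₀ : ℝ) / ((ν₀ : ℝ) - 2) - 3 / 4 := by
  have h3 : (3 : ℝ) ≤ ν₀ := by exact_mod_cast hν₀
  have hle' : (ν₀ : ℝ) ≤ ν := by exact_mod_cast hle
  have h1 : (ν : ℝ) / ((ν : ℝ) - 2) ≤ (ν₀ : ℝ) / ((ν₀ : ℝ) - 2) := by
    rw [div_le_div_iff₀ (by linarith) (by linarith)]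
    nlinarith
  linarith

/-- The two bounds of Prop. 4.2 (2) as antitone functions on `{ν | 3 ≤ ν}`.
[cite: SalmhoferSeiler1991, Prop. 4.2 (2)] -/
theorem fluctSBound_antitoneOn :
    AntitoneOn (fun ν : ℕ => (ν : ℝ) * latticeGreen (0 : Site ν) - 3 / 4) {ν | 3 ≤ ν} ∧
      AntitoneOn (fun ν : ℕ => (ν : ℝ) / ((ν : ℝ) - 2) - 3 / 4) {ν | 3 ≤ ν} :=
  ⟨fun _ hν₀ _ _ hle => fluctSBound_le_of_le hν₀ hle,
    fun _ hν₀ _ _ hle => dimBound_le_of_le hν₀ hle⟩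

/-- **(A.61): `S(ν) ≤ ν₀R(ν₀) - 3/4` for every `ν ≥ ν₀ ≥ 3`** — "the inequality follows from the
fact that the upper bound `S(ν) ≤ νR(ν) - 3/4` is decreasing" (`fluctS_le` and Proposition A.6).
[cite: SalmhoferSeiler1991, (A.61) with Prop. 4.2 (2) and Proposition A.6] -/
theorem fluctS_le_of_le (hν₀ : 3 ≤ ν₀) (hle : ν₀ ≤ ν) :
    fluctS ν ≤ (ν₀ : ℝ) * latticeGreen (0 : Site ν₀) - 3 / 4 :=
  (fluctS_le (hν₀.trans hle)).trans (fluctSBound_le_of_le hν₀ hle)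

/-! ### Thm. 4.8 / Cor. 4.9 for all `ν ≥ ν₀` from one inequality at `ν₀` -/

/-- **Thm. 4.8 in all dimensions `ν ≥ ν₀`**: for a complex spin system with `B = exp(NW)` to order
`N`, `w₁ = 1`, `w_k ≥ 0`, if `2(ν₀R(ν₀) - 3/4)K(N)/N < 1` at some `ν₀ ≥ 3` then in EVERY dimension
`ν ≥ ν₀` there are `c > 0`, `L₀` with `|Λ|⁻¹∑_x⟨σ_0σ_x⟩_Λ ≥ c` for all even `L ≥ L₀` (chiral LRO at
`m = 0`, uniform in the volume).  [cite: SalmhoferSeiler1991, Thm. 4.8 with Prop. 4.2 (2) and Proposition A.6] -/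
theorem chiralLRO_of_latticeGreen_lt (hν₀ : 3 ≤ ν₀) (hle : ν₀ ≤ ν) {N : ℕ} (hN : 1 ≤ N)
    {a w : ℕ → ℝ} (hlog : HasLog N a w) (ha0 : a 0 = 1) (hw1 : w 1 = 1)
    (hw : ∀ k, 2 ≤ k → k ≤ N → 0 ≤ w k)
    (hcond : 2 * ((ν₀ : ℝ) * latticeGreen (0 : Site ν₀) - 3 / 4) * sdK N w / N < 1) :
    ∃ c : ℝ, 0 < c ∧ ∃ L₀ : ℕ, ∀ (L : ℕ) [NeZero L], Even L → L₀ ≤ L →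
      c ≤ (Fintype.card (TorusSite ν L) : ℝ)⁻¹ *
          ∑ x : TorusSite ν L, expect N 0 a (MvPolynomial.X (0 : TorusSite ν L) * MvPolynomial.X x) := by
  have hK : 0 < sdK N w := lt_of_lt_of_le one_pos (one_le_sdK hN hw1 hw)
  have hNpos : (0 : ℝ) < N := by exact_mod_cast hN
  refine chiralLRO_of_fluctS_lt (hν₀.trans hle) hN hlog ha0 hw1 hw (lt_of_le_of_lt ?_ hcond)
  have h := fluctS_le_of_le (ν := ν) hν₀ hle
  have : 2 * fluctS ν * sdK N w ≤
      2 * ((ν₀ : ℝ) * latticeGreen (0 : Site ν₀) - 3 / 4) * sdK N w := by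
    nlinarith
  exact div_le_div_of_nonneg_right this hNpos.le

/-- **Cor. 4.9 in all dimensions `ν ≥ ν₀`** for the `U(N)` model, `1 ≤ N ≤ 4`: if
`2(ν₀R(ν₀) - 3/4)K(N)/N < 1` at some `ν₀ ≥ 3` then chiral LRO at `m = 0` holds in every even volume
large enough, in every dimension `ν ≥ ν₀`. [cite: SalmhoferSeiler1991, Cor. 4.9 with Prop. 4.2 (2) and Proposition A.6] -/
theorem uN_chiralLRO_of_latticeGreen_lt (hν₀ : 3 ≤ ν₀) (hle : ν₀ ≤ ν) {N : ℕ} (hN1 : 1 ≤ N)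
    (hN4 : N ≤ 4)
    (hcond : 2 * ((ν₀ : ℝ) * latticeGreen (0 : Site ν₀) - 3 / 4) * sdK N (uNLogCoeff N) / N < 1) :
    ∃ c : ℝ, 0 < c ∧ ∃ L₀ : ℕ, ∀ (L : ℕ) [NeZero L], Even L → L₀ ≤ L →
      c ≤ (Fintype.card (TorusSite ν L) : ℝ)⁻¹ *
          ∑ x : TorusSite ν L, expect N 0 (uNBondCoeff N)
            (MvPolynomial.X (0 : TorusSite ν L) * MvPolynomial.X x) :=
  chiralLRO_of_latticeGreen_lt hν₀ hle hN1 (hasLog_uN hN1 hN4) (uNBondCoeff_zero N)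
    (uNLogCoeff_one N) (fun k hk2 hkN => uNLogCoeff_nonneg hN4 k hk2 hkN) hcond

/-! ### (A.60): the printed `ν ≥ 4` claims, conditional on the printed values of `R(ν₀)` -/

/-- **(A.60) for `U(1)` (strongly coupled lattice QED with massless staggered fermions, `K(1) = 1`)**:
"`S(4) ≤ 4R(4) - 3/4 < 1/2`, so that already this bound suffices to prove symmetry breaking for QED
[…] for `ν = 4` (and also all `ν ≥ 4` …)" — GIVEN the computer-assisted value `R(4) < 5/16 = 0.3125`
(printed: `R(4) ≤ 0.3100`, p. 430; NOT formalised, kept as the hypothesis `hR`), chiral LRO at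
`m = 0` holds in every dimension `ν ≥ 4`. [cite: SalmhoferSeiler1991, (A.60) p. 430 with Proposition A.6 and Cor. 4.9] -/
theorem u1_chiralLRO_of_latticeGreen_four_lt (hR : latticeGreen (0 : Site 4) < 5 / 16) (hν : 4 ≤ ν) :
    ∃ c : ℝ, 0 < c ∧ ∃ L₀ : ℕ, ∀ (L : ℕ) [NeZero L], Even L → L₀ ≤ L →
      c ≤ (Fintype.card (TorusSite ν L) : ℝ)⁻¹ *
          ∑ x : TorusSite ν L, expect 1 0 (uNBondCoeff 1)
            (MvPolynomial.X (0 : TorusSite ν L) * MvPolynomial.X x) := by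
  refine uN_chiralLRO_of_latticeGreen_lt (ν₀ := 4) (by norm_num) hν le_rfl (by norm_num) ?_
  rw [sdK_uN_one, Nat.cast_one]
  push_cast
  linarith

/-- **(A.60) for `U(2)` (`K(2) = 2`)**: given `R(4) < 5/16` (printed: `R(4) ≤ 0.3100`), chiral LRO at
`m = 0` in every dimension `ν ≥ 4`. [cite: SalmhoferSeiler1991, (A.60) p. 430 with Proposition A.6 and Cor. 4.9] -/
theorem u2_chiralLRO_of_latticeGreen_four_lt (hR : latticeGreen (0 : Site 4) < 5 / 16) (hν : 4 ≤ ν) :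
    ∃ c : ℝ, 0 < c ∧ ∃ L₀ : ℕ, ∀ (L : ℕ) [NeZero L], Even L → L₀ ≤ L →
      c ≤ (Fintype.card (TorusSite ν L) : ℝ)⁻¹ *
          ∑ x : TorusSite ν L, expect 2 0 (uNBondCoeff 2)
            (MvPolynomial.X (0 : TorusSite ν L) * MvPolynomial.X x) := by
  refine uN_chiralLRO_of_latticeGreen_lt (ν₀ := 4) (by norm_num) hν (by norm_num) (by norm_num) ?_
  rw [sdK_uN_two, Nat.cast_ofNat]
  push_cast
  linarith

/-- `U(3)` (`K(3) = 10/3`) in every dimension `ν ≥ 5`, given the computer-assisted `R(5) < 6/25 = 0.24`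
(printed: `R(5) ≤ 0.2313`, p. 430): `2(5R(5) - 3/4)(10/3)/3 < 1 ⟺ R(5) < 6/25`.  (At `ν = 4` the
printed claim for `U(3)` needs `S(4) < 0.45`, i.e. Prop. 4.2 (4), not (A.60).)
[cite: SalmhoferSeiler1991, p. 430 (table of `R(ν)`) with Proposition A.6 and Cor. 4.9] -/
theorem u3_chiralLRO_of_latticeGreen_five_lt (hR : latticeGreen (0 : Site 5) < 6 / 25) (hν : 5 ≤ ν) :
    ∃ c : ℝ, 0 < c ∧ ∃ L₀ : ℕ, ∀ (L : ℕ) [NeZero L], Even L → L₀ ≤ L →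
      c ≤ (Fintype.card (TorusSite ν L) : ℝ)⁻¹ *
          ∑ x : TorusSite ν L, expect 3 0 (uNBondCoeff 3)
            (MvPolynomial.X (0 : TorusSite ν L) * MvPolynomial.X x) := by
  refine uN_chiralLRO_of_latticeGreen_lt (ν₀ := 5) (by norm_num) hν (by norm_num) (by norm_num) ?_
  rw [sdK_uN_three, Nat.cast_ofNat]
  push_cast
  linarith

/-- `U(4)` (`K(4) = 83/15`) in every dimension `ν ≥ 7`, given the computer-assisted
`R(7) < 369/2324 ≈ 0.1588` (printed: `R(7) ≤ 0.1564`, p. 430):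
`2(7R(7) - 3/4)(83/15)/4 < 1 ⟺ R(7) < 369/2324`.  (`ν = 4, 5, 6` for `U(4)` need Prop. 4.2 (4).)
[cite: SalmhoferSeiler1991, p. 430 (table of `R(ν)`) with Proposition A.6 and Cor. 4.9] -/
theorem u4_chiralLRO_of_latticeGreen_seven_lt (hR : latticeGreen (0 : Site 7) < 369 / 2324)
    (hν : 7 ≤ ν) :
    ∃ c : ℝ, 0 < c ∧ ∃ L₀ : ℕ, ∀ (L : ℕ) [NeZero L], Even L → L₀ ≤ L →
      c ≤ (Fintype.card (TorusSite ν L) : ℝ)⁻¹ *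
          ∑ x : TorusSite ν L, expect 4 0 (uNBondCoeff 4)
            (MvPolynomial.X (0 : TorusSite ν L) * MvPolynomial.X x) := by
  refine uN_chiralLRO_of_latticeGreen_lt (ν₀ := 7) (by norm_num) hν (by norm_num) le_rfl ?_
  rw [sdK_uN_four, Nat.cast_ofNat]
  push_cast
  linarith

end ComplexSpin

end Literature.MathematicalPhysics.StatisticalMechanics

end
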